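import Summits.QuantumFields.YangMills.Theorems.UnitScaleTiltProp7SymFrameUnitary
import HarnessLib

/-!
# Route `UnitScaleTilt`, crux K1 child «MinimiserStabilityRegPr» (stmt-QuantumFields-19200), skeleton v10 stub EX, route (α) — the BOND-clause twins of ✓`…SymFrameUnitary`
# (★w4-20520 g3's ask for `…ChartRealityTwS` v1.1): **THE COVARIANT DOUBLE-BAR TOWER AND THE RE-BASED DOUBLE BAR `dbarTwS` OF SU(2) DATA ARE SPECIAL UNITARY**

* §1 ★`dbarCovIterU_emlIterU_mem_specialUnitaryGroup_of_plaqSmall` — at a curved plaquette-small SU(2) background and an SU(2)-valued perturbation `e^{A}U₀♭` with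
  `‖A(b)‖ ≤ t ≤ 1`, under W2's budgets at `(s₀, δ) = (s_B, 2t)`: `U̿^{(k)}(U₀♭, e^{A}U₀♭)(e) ∈ SU(2)` AND `Ū₀^{(k)}(e) ∈ SU(2)` for every level-`k` bond `e` — the bond clause of
  ✓`pred_dbarCovIterU_frameAccU_of_reads` at `p := (· ∈ SU(2))` for the gauged pair in the cluster axial gauge of the two blocks of `e` (✓`dist1_axial_cluster_le`), un-gauged at
  both ends by W0 ✓`Prop7SymFrameCovariance.dbarCovIterU_gaugeActT` ∕ ✓`Prop8Chart.emlIterU_gaugeActT` (conjugation-type products of SU(2) elements);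
* §2 ★★`dbarTwS_mem_specialUnitaryUnits_of_regPr` — the T³ letter: for `RegPr F n K ε₀ U₀`, `10¹²L³ε₀ ≤ 1`, `10⁹L²e ≤ 1`, a bondwise self-adjoint traceless datum `X` with
  `‖X(b)‖ ≤ e·η`: `dbarTwS F n K h U₀ (i·X) c ∈ specialUnitaryUnits (Fin 2)` — print's (92) ✓`Prop7SymAvgTwSym.dbarTwS_eq_dbarCovIterU_mul_inv` ∘ §1 at the route's letters (the budgets
  exactly as in ✓`frameTwS_mem_specialUnitaryUnits_of_regPr`).

Cell `ym3-torus`, seat ym-ust-20520-w3 (gen 4); def-free; YM₃ on T³ is rung R3, not the Clay problem; count-neutral toward stmt-QuantumFields-19200.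

References: T. Bałaban, CMP **98** (1985) 17–51 [Balaban1985Averaging] ((11)–(12) p.19, (89)–(92) p.31, (127) p.37, Prop. 4 (134)–(135) p.38, (159)–(163) p.42);
CMP **109** (1987) 249–301 [Balaban1987RG1] ((0.9)–(0.11) p.253); CMP **102** (1985) 277–309 [Balaban1985Variational] ((7) p.278, (152) p.301).
-/

noncomputable section

open Literature.MathematicalPhysics.QuantumFieldTheory.Balaban1983to89
open T4Continuum BlockAveraging ExpMeanLog
open B5Eq118OneStroke (iterBlockOf)
open NormedSpace
open B15DeterminingSets (embIter)
open B7Prop1Explicit (expUnit val_expUnit)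
open B7Prop2SpecialUnitary (specialUnitaryUnits mem_specialUnitaryUnits)
open B10Eq27TorusAxialLog (gaugeActT gaugeActT_apply axialT unitsField toUField suIncl)
open Summit.QuantumFields.YangMills.Theorems.Prop8Chart (coe_unitsField_toUField emlAvgU emlIterU emlIterU_gaugeActT)

namespace Summit.QuantumFields.YangMills.Theorems.Prop7SymFrameBound

open Summit.QuantumFields.YangMills.Theorems.Prop7SymAvgTwSym (vframeCovU dbarCovU dbarCovIterU frameAccU)

variable {P : Params}

open scoped Matrix.Norms.L2Operator

/-! ## §1 The SU(2) background: the tower bond variable and the background tower are special unitary -/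

section SU2

open Summit.QuantumFields.YangMills.Theorems.Prop7SymAvgRelativeBound (norm_coe_toUnits_suIncl norm_coe_toUnits_suIncl_inv unitsField_toUField_gaugeActT
  gaugeActT_mul_bg coe_toUnits_suIncl)
open Summit.QuantumFields.YangMills.Theorems.IterPlaqSmallAllL (dist1_axial_cluster_le)
open Summit.QuantumFields.YangMills.Theorems.Prop7SymFrameCovariance (dbarCovIterU_gaugeActT)

/-- ★ **THE COVARIANT DOUBLE-BAR TOWER BOND VARIABLE AND THE BACKGROUND TOWER OF SU(2) DATA ARE SPECIAL UNITARY** at a curved plaquette-small SU(2) background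
(`PlaqSmall a₀ U₀`, `k + 1 ≤ m + K`), for an SU(2)-valued perturbation `W = e^{A}U₀♭` (`e^{A(b)} ∈ SU(2)`, `‖A(b)‖ ≤ t ≤ 1`), under W2's budgets at `(s_B, 2t)` and
`48ℓ(2Lᵏ(2t + 30ℓs_B) + 30ℓLᵏs_B) ≤ 1`: `U̿^{(k)}(U₀♭, W)(e) ∈ SU(2) ∧ Ū₀^{(k)}(e) ∈ SU(2)`. [cite: Balaban1985Averaging, (89) p.31, (127) p.37, (11)-(12) p.19; Balaban1987RG1, (0.9)-(0.11) p.253] -/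
theorem dbarCovIterU_emlIterU_mem_specialUnitaryGroup_of_plaqSmall {C₁ : ℝ} (hC₁ : 2 ≤ C₁)
    (hstep : ∀ (j : ℕ), j + 1 ≤ P.m + P.K → ∀ (U₀ W : GaugeField P j (Matrix (Fin 2) (Fin 2) ℂ)ˣ) (c : PBond P (j + 1)) (s₀ s₁ δ : ℝ),
      0 ≤ s₀ → 0 ≤ s₁ → 0 ≤ δ → 120 * (((P.d + 2) * P.L : ℕ) : ℝ) * (s₀ + s₁) ≤ 1 →
      (∀ b : PBond P j, (blockOf b.src = c.src ∨ blockOf b.src = c.tgt) → (blockOf b.tgt = c.src ∨ blockOf b.tgt = c.tgt) →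
        ‖((U₀ b : (Matrix (Fin 2) (Fin 2) ℂ)ˣ) : Matrix (Fin 2) (Fin 2) ℂ) - 1‖ ≤ s₀ ∧ ‖((W b : (Matrix (Fin 2) (Fin 2) ℂ)ˣ) : Matrix (Fin 2) (Fin 2) ℂ) - 1‖ ≤ s₁ ∧
          ‖((W b : (Matrix (Fin 2) (Fin 2) ℂ)ˣ) : Matrix (Fin 2) (Fin 2) ℂ) - ((U₀ b : (Matrix (Fin 2) (Fin 2) ℂ)ˣ) : Matrix (Fin 2) (Fin 2) ℂ)‖ ≤ δ) →
      ‖((dbarCovU U₀ W c : (Matrix (Fin 2) (Fin 2) ℂ)ˣ) : Matrix (Fin 2) (Fin 2) ℂ) * (((emlAvgU U₀ c)⁻¹ : (Matrix (Fin 2) (Fin 2) ℂ)ˣ) : Matrix (Fin 2) (Fin 2) ℂ) - 1‖ ≤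
        (P.L : ℝ) * δ + C₁ * (((P.d + 2) * P.L : ℕ) : ℝ) ^ 2 * (s₀ + s₁) ^ 2)
    (hframe : ∀ (j : ℕ), j + 1 ≤ P.m + P.K → ∀ (U₀ W : GaugeField P j (Matrix (Fin 2) (Fin 2) ℂ)ˣ) (y : Site P (j + 1)) (s₀ s₁ δ : ℝ),
      0 ≤ s₀ → 0 ≤ s₁ → 0 ≤ δ → 120 * (((P.d + 2) * P.L : ℕ) : ℝ) * (s₀ + s₁) ≤ 1 →
      (∀ b : PBond P j, blockOf b.src = y → blockOf b.tgt = y →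
        ‖((U₀ b : (Matrix (Fin 2) (Fin 2) ℂ)ˣ) : Matrix (Fin 2) (Fin 2) ℂ) - 1‖ ≤ s₀ ∧ ‖((W b : (Matrix (Fin 2) (Fin 2) ℂ)ˣ) : Matrix (Fin 2) (Fin 2) ℂ) - 1‖ ≤ s₁ ∧
          ‖((W b : (Matrix (Fin 2) (Fin 2) ℂ)ˣ) : Matrix (Fin 2) (Fin 2) ℂ) - ((U₀ b : (Matrix (Fin 2) (Fin 2) ℂ)ˣ) : Matrix (Fin 2) (Fin 2) ℂ)‖ ≤ δ) →
      ‖((vframeCovU U₀ W y : (Matrix (Fin 2) (Fin 2) ℂ)ˣ) : Matrix (Fin 2) (Fin 2) ℂ) - 1‖ ≤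
        (((P.d + 2) * P.L : ℕ) : ℝ) * δ + C₁ * (((P.d + 2) * P.L : ℕ) : ℝ) ^ 2 * (s₀ + s₁) ^ 2)
    {k : ℕ} (hk : k + 1 ≤ P.m + P.K) (U₀ : GaugeField P 0 (Matrix.specialUnitaryGroup (Fin 2) ℂ)) {a₀ : ℝ} (ha₀ : 0 < a₀) (hU : PlaqSmall a₀ U₀)
    (A : PBond P 0 → Matrix (Fin 2) (Fin 2) ℂ) {t : ℝ} (ht0 : 0 ≤ t) (ht1 : t ≤ 1) (hA : ∀ b, ‖A b‖ ≤ t)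
    (hAsu : ∀ b, ((expUnit (A b) : (Matrix (Fin 2) (Fin 2) ℂ)ˣ) : Matrix (Fin 2) (Fin 2) ℂ) ∈ Matrix.specialUnitaryGroup (Fin 2) ℂ)
    (hbud₀ : 6400 * (((P.d + 2) * P.L : ℕ) : ℝ) ^ 2 * (P.L : ℝ) ^ k * (2 * ((P.d : ℝ) * (3 * (P.L : ℝ) ^ k - 1)) * a₀) ≤ 1)
    (hbud : 8 * (16 * C₁ + 2) * (((P.d + 2) * P.L : ℕ) : ℝ) ^ 2 *
      ((P.L : ℝ) ^ k * (2 * t + 30 * (((P.d + 2) * P.L : ℕ) : ℝ) * (2 * ((P.d : ℝ) * (3 * (P.L : ℝ) ^ k - 1)) * a₀))) ≤ 1)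
    (hρ : 48 * (((P.d + 2) * P.L : ℕ) : ℝ) *
      (2 * ((P.L : ℝ) ^ k * (2 * t + 30 * (((P.d + 2) * P.L : ℕ) : ℝ) * (2 * ((P.d : ℝ) * (3 * (P.L : ℝ) ^ k - 1)) * a₀))) +
        30 * (((P.d + 2) * P.L : ℕ) : ℝ) * (P.L : ℝ) ^ k * (2 * ((P.d : ℝ) * (3 * (P.L : ℝ) ^ k - 1)) * a₀)) ≤ 1)
    (e : PBond P k) :
    ((dbarCovIterU k (unitsField (toUField U₀)) (fun b => expUnit (A b) * unitsField (toUField U₀) b) e : (Matrix (Fin 2) (Fin 2) ℂ)ˣ) : Matrix (Fin 2) (Fin 2) ℂ)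
        ∈ Matrix.specialUnitaryGroup (Fin 2) ℂ ∧
      ((emlIterU k (unitsField (toUField U₀)) e : (Matrix (Fin 2) (Fin 2) ℂ)ˣ) : Matrix (Fin 2) (Fin 2) ℂ) ∈ Matrix.specialUnitaryGroup (Fin 2) ℂ := by
  obtain ⟨h1, hmul, hinv, heml⟩ := su2_pred_closure (P := P)
  set sB : ℝ := 2 * ((P.d : ℝ) * (3 * (P.L : ℝ) ^ k - 1)) * a₀ with hsB
  set z : Site P k := e.src with hz
  set u : GaugeTransf P 0 (Matrix.specialUnitaryGroup (Fin 2) ℂ) := axialT U₀ (embIter k z) with hu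
  set û : GaugeTransf P 0 (Matrix (Fin 2) (Fin 2) ℂ)ˣ := fun x => Unitary.toUnits (suIncl (u x)) with hû
  set V₂ : GaugeField P 0 (Matrix (Fin 2) (Fin 2) ℂ)ˣ := unitsField (toUField U₀) with hV₂
  set W : GaugeField P 0 (Matrix (Fin 2) (Fin 2) ℂ)ˣ := fun b => expUnit (A b) * V₂ b with hW
  have hL1 : (1 : ℝ) ≤ P.L := by exact_mod_cast P.L_pos
  have hsB0 : 0 ≤ sB := by
    rw [hsB]
    have h3 : (0 : ℝ) ≤ 3 * (P.L : ℝ) ^ k - 1 := by linarith [one_le_pow₀ (n := k) hL1]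
    positivity
  -- SU(2)-valuedness of the letters
  have hûsu : ∀ x, ((û x : (Matrix (Fin 2) (Fin 2) ℂ)ˣ) : Matrix (Fin 2) (Fin 2) ℂ) ∈ Matrix.specialUnitaryGroup (Fin 2) ℂ := fun x => by
    rw [hû, coe_toUnits_suIncl]; exact (u x).2
  have hV₂su : ∀ b, ((V₂ b : (Matrix (Fin 2) (Fin 2) ℂ)ˣ) : Matrix (Fin 2) (Fin 2) ℂ) ∈ Matrix.specialUnitaryGroup (Fin 2) ℂ := fun b => by
    rw [hV₂, coe_unitsField_toUField]; exact (U₀ b).2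
  have hgsu : ∀ (g : GaugeTransf P 0 (Matrix (Fin 2) (Fin 2) ℂ)ˣ), (∀ x, ((g x : (Matrix (Fin 2) (Fin 2) ℂ)ˣ) : Matrix (Fin 2) (Fin 2) ℂ) ∈ Matrix.specialUnitaryGroup (Fin 2) ℂ) →
      ∀ (V : GaugeField P 0 (Matrix (Fin 2) (Fin 2) ℂ)ˣ), (∀ b, ((V b : (Matrix (Fin 2) (Fin 2) ℂ)ˣ) : Matrix (Fin 2) (Fin 2) ℂ) ∈ Matrix.specialUnitaryGroup (Fin 2) ℂ) →
      ∀ b, ((gaugeActT g V b : (Matrix (Fin 2) (Fin 2) ℂ)ˣ) : Matrix (Fin 2) (Fin 2) ℂ) ∈ Matrix.specialUnitaryGroup (Fin 2) ℂ := by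
    intro g hg V hV b
    rw [gaugeActT_apply, Units.val_mul, Units.val_mul]
    exact hmul _ _ (hmul _ _ (hg _) (hV b)) (hinv _ (hg _))
  have hWsu : ∀ b, ((W b : (Matrix (Fin 2) (Fin 2) ℂ)ˣ) : Matrix (Fin 2) (Fin 2) ℂ) ∈ Matrix.specialUnitaryGroup (Fin 2) ℂ := fun b => by
    rw [hW]; simp only [Units.val_mul]; exact hmul _ _ (hAsu b) (hV₂su b)
  -- the two top-level sites of `e` and the reads in the cluster axial gauge
  set S : Set (Site P k) := {w | w = z ∨ w = z.shift e.dir ∨ w = z.shift e.dir ∨ w = (z.shift e.dir).shift e.dir} with hS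
  have hsrc : e.src ∈ S := Or.inl hz.symm
  have htgt : e.tgt ∈ S := Or.inr (Or.inl rfl)
  have hreads : ∀ b : PBond P 0, iterBlockOf k b.src ∈ S → iterBlockOf k b.tgt ∈ S →
      ‖((gaugeActT û V₂ b : (Matrix (Fin 2) (Fin 2) ℂ)ˣ) : Matrix (Fin 2) (Fin 2) ℂ) - 1‖ ≤ sB ∧
        ‖((gaugeActT û W b : (Matrix (Fin 2) (Fin 2) ℂ)ˣ) : Matrix (Fin 2) (Fin 2) ℂ) - ((gaugeActT û V₂ b : (Matrix (Fin 2) (Fin 2) ℂ)ˣ) : Matrix (Fin 2) (Fin 2) ℂ)‖ ≤ 2 * t := by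
    intro b hbs hbt
    have hB : ‖((gaugeActT û V₂ b : (Matrix (Fin 2) (Fin 2) ℂ)ˣ) : Matrix (Fin 2) (Fin 2) ℂ) - 1‖ ≤ sB := by
      rw [hû, hV₂, ← unitsField_toUField_gaugeActT, coe_unitsField_toUField, ← SU2Mean.dist1_eq_norm, hu]
      exact dist1_axial_cluster_le hk U₀ ha₀ hU z e.dir e.dir b hbs hbt
    refine ⟨hB, ?_⟩
    have hG1 : ‖((gaugeActT û V₂ b : (Matrix (Fin 2) (Fin 2) ℂ)ˣ) : Matrix (Fin 2) (Fin 2) ℂ)‖ ≤ 1 := by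
      have hm := hgsu û hûsu V₂ hV₂su b
      exact (Summit.QuantumFields.YangMills.Theorems.Prop8Criticality.norm_coe_su2 ⟨_, hm⟩).le
    have hE : ‖((expUnit (A b) : (Matrix (Fin 2) (Fin 2) ℂ)ˣ) : Matrix (Fin 2) (Fin 2) ℂ) - 1‖ ≤ 2 * t := by
      rw [val_expUnit]
      exact (B7TransferAnalyticMean.norm_exp_sub_one_le_two_mul ((hA b).trans ht1)).trans (by linarith [hA b])
    have hval : ((gaugeActT û W b : (Matrix (Fin 2) (Fin 2) ℂ)ˣ) : Matrix (Fin 2) (Fin 2) ℂ) - ((gaugeActT û V₂ b : (Matrix (Fin 2) (Fin 2) ℂ)ˣ) : Matrix (Fin 2) (Fin 2) ℂ) =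
        (((û b.src : (Matrix (Fin 2) (Fin 2) ℂ)ˣ) : Matrix (Fin 2) (Fin 2) ℂ) * (((expUnit (A b) : (Matrix (Fin 2) (Fin 2) ℂ)ˣ) : Matrix (Fin 2) (Fin 2) ℂ) - 1) *
          (((û b.src)⁻¹ : (Matrix (Fin 2) (Fin 2) ℂ)ˣ) : Matrix (Fin 2) (Fin 2) ℂ)) * ((gaugeActT û V₂ b : (Matrix (Fin 2) (Fin 2) ℂ)ˣ) : Matrix (Fin 2) (Fin 2) ℂ) := by
      rw [hW, gaugeActT_mul_bg, Units.val_mul, Units.val_mul, Units.val_mul]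
      rw [mul_sub, sub_mul, sub_mul, mul_one, Units.mul_inv, one_mul]
    rw [hval]
    calc _ ≤ ‖((û b.src : (Matrix (Fin 2) (Fin 2) ℂ)ˣ) : Matrix (Fin 2) (Fin 2) ℂ) * (((expUnit (A b) : (Matrix (Fin 2) (Fin 2) ℂ)ˣ) : Matrix (Fin 2) (Fin 2) ℂ) - 1) *
          (((û b.src)⁻¹ : (Matrix (Fin 2) (Fin 2) ℂ)ˣ) : Matrix (Fin 2) (Fin 2) ℂ)‖ * ‖((gaugeActT û V₂ b : (Matrix (Fin 2) (Fin 2) ℂ)ˣ) : Matrix (Fin 2) (Fin 2) ℂ)‖ :=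
          norm_mul_le _ _
      _ ≤ (‖((û b.src : (Matrix (Fin 2) (Fin 2) ℂ)ˣ) : Matrix (Fin 2) (Fin 2) ℂ) * (((expUnit (A b) : (Matrix (Fin 2) (Fin 2) ℂ)ˣ) : Matrix (Fin 2) (Fin 2) ℂ) - 1)‖ *
          ‖(((û b.src)⁻¹ : (Matrix (Fin 2) (Fin 2) ℂ)ˣ) : Matrix (Fin 2) (Fin 2) ℂ)‖) * 1 := by
          gcongr
          exact norm_mul_le _ _
      _ ≤ ((‖((û b.src : (Matrix (Fin 2) (Fin 2) ℂ)ˣ) : Matrix (Fin 2) (Fin 2) ℂ)‖ * ‖((expUnit (A b) : (Matrix (Fin 2) (Fin 2) ℂ)ˣ) : Matrix (Fin 2) (Fin 2) ℂ) - 1‖) * 1) * 1 := by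
          gcongr
          · exact norm_mul_le _ _
          · exact (norm_coe_toUnits_suIncl_inv (u b.src)).le
      _ ≤ ((1 * (2 * t)) * 1) * 1 := by
          gcongr
          exact (norm_coe_toUnits_suIncl (u b.src)).le
      _ = 2 * t := by ring
  have hpg : ∀ b : PBond P 0, iterBlockOf k b.src ∈ S → iterBlockOf k b.tgt ∈ S →
      ((gaugeActT û W b : (Matrix (Fin 2) (Fin 2) ℂ)ˣ) : Matrix (Fin 2) (Fin 2) ℂ) ∈ Matrix.specialUnitaryGroup (Fin 2) ℂ ∧
        ((gaugeActT û V₂ b : (Matrix (Fin 2) (Fin 2) ℂ)ˣ) : Matrix (Fin 2) (Fin 2) ℂ) ∈ Matrix.specialUnitaryGroup (Fin 2) ℂ :=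
    fun b _ _ => ⟨hgsu û hûsu W hWsu b, hgsu û hûsu V₂ hV₂su b⟩
  -- part 1's predicate row for the gauged pair: the BOND clause
  have h2t : 0 ≤ 2 * t := by positivity
  obtain ⟨hΨ, -⟩ := pred_dbarCovIterU_frameAccU_of_reads (fun M : Matrix (Fin 2) (Fin 2) ℂ => M ∈ Matrix.specialUnitaryGroup (Fin 2) ℂ) h1 hmul hinv heml hC₁ hstep hframe
    (gaugeActT û V₂) (gaugeActT û W) (Nat.le_of_succ_le hk) hsB0 h2t hbud₀ hbud hρ k le_rfl S hreads hpg
  obtain ⟨hWg, hUg⟩ := hΨ e hsrc htgt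
  -- un-gauging at both ends
  have hTsu : ∀ (i : ℕ) (y : Site P i), ((transfUp û i y : (Matrix (Fin 2) (Fin 2) ℂ)ˣ) : Matrix (Fin 2) (Fin 2) ℂ) ∈ Matrix.specialUnitaryGroup (Fin 2) ℂ := by
    intro i
    induction i with
    | zero => intro y; exact hûsu y
    | succ i ih => intro y; exact ih (emb y)
  have keyW : dbarCovIterU k V₂ W e = (transfUp û k e.src)⁻¹ * dbarCovIterU k (gaugeActT û V₂) (gaugeActT û W) e * transfUp û k e.tgt := by
    have hg := dbarCovIterU_gaugeActT (transfUp û) (fun _ _ => rfl) V₂ W k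
    rw [show gaugeActT (transfUp û 0) = gaugeActT û from rfl] at hg
    rw [hg, gaugeActT_apply]; group
  have keyU : emlIterU k V₂ e = (transfUp û k e.src)⁻¹ * emlIterU k (gaugeActT û V₂) e * transfUp û k e.tgt := by
    have hg := emlIterU_gaugeActT (transfUp û) (fun _ _ => rfl) V₂ k
    rw [show gaugeActT (transfUp û 0) = gaugeActT û from rfl] at hg
    rw [hg, gaugeActT_apply]; group
  refine ⟨?_, ?_⟩
  · rw [keyW, Units.val_mul, Units.val_mul]
    exact hmul _ _ (hmul _ _ (hinv _ (hTsu k e.src)) hWg) (hTsu k e.tgt)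
  · rw [keyU, Units.val_mul, Units.val_mul]
    exact hmul _ _ (hmul _ _ (hinv _ (hTsu k e.src)) hUg) (hTsu k e.tgt)

end SU2

/-! ## §2 The T³ letter: `dbarTwS U₀ (i·X) c ∈ SU(2)` at a printed-regular background -/

section T3

open T3ContinuumYM3Torus
open T3PrintedRegularMinimiser (RegPr)
open T3LevelShift (siteShift bondShift)
open T3PrintedRegularOrbits (sites_eq)
open T3SectALandauChart (bgUnits eta eta_pos)
open T3RegularMinimiser (regThreshold)
open Summit.QuantumFields.YangMills.Theorems.Prop7SymAvgTwSym (dbarTwS dbarTwS_eq_dbarCovIterU_mul_inv)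

variable (F : T3Family) {n K : ℕ} (h : n ≤ K)

/-- ★★ **THE RE-BASED DOUBLE BAR OF SU(2) DATA IS SPECIAL UNITARY AT A PRINTED-REGULAR BACKGROUND**: for `RegPr F n K ε₀ U₀` with `10¹²L³ε₀ ≤ 1`, `10⁹L²e ≤ 1`, and a
bondwise self-adjoint traceless datum `X` with `‖X(b)‖ ≤ e·η`, every `dbarTwS F n K h U₀ (i·X) c` lies in `specialUnitaryUnits (Fin 2)` — print's (92)
`U̿^{twS}(c) = U̿^{(k)}(U₀♭, e^{iX}U₀♭)(ĉ)·Ū₀^{(k)}(ĉ)⁻¹` (✓`dbarTwS_eq_dbarCovIterU_mul_inv`) with both factors special unitary by §1 (letters and budgets exactly as in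
✓`frameTwS_mem_specialUnitaryUnits_of_regPr`).  The `hSUball` supplier of ★w4-20520 g3's `…ChartRealityTwS`.
[cite: Balaban1985Averaging, (92) p.31, (127) p.37; Balaban1985Variational, (7) p.278, (152) p.301] -/
theorem dbarTwS_mem_specialUnitaryUnits_of_regPr {ε₀ e : ℝ} (hε₀ : 0 < ε₀) (he : 0 ≤ e) (hε : 10 ^ 12 * (F.L : ℝ) ^ 3 * ε₀ ≤ 1)
    (he9 : 10 ^ 9 * (F.L : ℝ) ^ 2 * e ≤ 1) (U₀ : GaugeField (F.P K) 0 (Matrix.specialUnitaryGroup (Fin 2) ℂ)) (hreg : RegPr F n K ε₀ U₀)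
    (X : PBond (F.P K) 0 → Matrix (Fin 2) (Fin 2) ℂ) (hXsa : ∀ b, IsSelfAdjoint (X b)) (hXtr : ∀ b, Matrix.trace (X b) = 0) (hX : ∀ b, ‖X b‖ ≤ e * eta F n K)
    (c : PBond (F.P n) 0) :
    dbarTwS F n K h U₀ (fun b => Complex.I • X b) c ∈ specialUnitaryUnits (Fin 2) := by
  -- letters (as in `frameTwS_mem_specialUnitaryUnits_of_regPr`)
  have hd : (F.P K).d = 3 := T3Family.P_d F K
  have hLn : (F.P K).L = F.L := rfl
  have hL3 : 3 ≤ F.L := by obtain ⟨a, ha⟩ := F.hL.1; have := F.hL.2; omega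
  have hL3r : (3 : ℝ) ≤ F.L := by exact_mod_cast hL3
  have hL0 : (0 : ℝ) < F.L := by linarith
  have hL1 : (1 : ℝ) ≤ F.L := by linarith
  have hk1 : K - n + 1 ≤ (F.P K).m + (F.P K).K := by
    show K - n + 1 ≤ F.m + K; have := F.hm; omega
  set Xp : ℝ := (F.L : ℝ) ^ (K - n) with hXp
  have hX1 : 1 ≤ Xp := one_le_pow₀ hL1
  have hX0 : 0 < Xp := by positivity
  have hXη : Xp * eta F n K = 1 := by
    show (F.L : ℝ) ^ (K - n) * ((F.L : ℝ)⁻¹) ^ (K - n) = 1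
    rw [inv_pow, mul_inv_cancel₀ (pow_ne_zero _ hL0.ne')]
  have hη0 : 0 < eta F n K := eta_pos F n K
  set a₀ : ℝ := regThreshold F n K ε₀ with ha₀
  have ha₀0 : 0 < a₀ := by rw [ha₀]; unfold regThreshold; positivity
  have hXa : Xp * (Xp * a₀) = ε₀ := by
    have hX2 : Xp * Xp = (F.L : ℝ) ^ (2 * (K - n)) := by rw [hXp, ← pow_add, two_mul]
    have ha : a₀ = ε₀ * ((F.L : ℝ) ^ (2 * (K - n)))⁻¹ := by rw [ha₀]; unfold regThreshold; rw [inv_pow]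
    rw [← mul_assoc, hX2, ha, mul_comm ε₀, ← mul_assoc, mul_inv_cancel₀ (pow_ne_zero _ hL0.ne'), one_mul]
  have hU : PlaqSmall a₀ U₀ := hreg.1
  set t : ℝ := e * eta F n K with ht
  have ht0 : 0 ≤ t := by positivity
  have hXt : Xp * t = e := by rw [ht, mul_left_comm, hXη, mul_one]
  have he1 : e ≤ 1 := by nlinarith [mul_nonneg (by norm_num : (0 : ℝ) ≤ 10 ^ 9) (mul_nonneg (sq_nonneg (F.L : ℝ)) he)]
  have ht1 : t ≤ 1 := by
    have hη1 : eta F n K ≤ 1 := by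
      have : eta F n K = Xp⁻¹ := eq_inv_of_mul_eq_one_right hXη
      rw [this]; exact inv_le_one_of_one_le₀ hX1
    calc t = e * eta F n K := rfl
      _ ≤ 1 * 1 := mul_le_mul he1 hη1 hη0.le zero_le_one
      _ = 1 := one_mul 1
  have hA : ∀ b, ‖Complex.I • X b‖ ≤ t := fun b => by rw [norm_smul, Complex.norm_I, one_mul]; exact hX b
  set sB : ℝ := 2 * (((3 : ℕ) : ℝ) * (3 * Xp - 1)) * a₀ with hsB
  have hsB0 : 0 ≤ sB := by
    rw [hsB]; have : (0 : ℝ) ≤ 3 * Xp - 1 := by linarith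
    positivity
  have hXsB : Xp * sB ≤ 18 * ε₀ := by
    rw [hsB, ← hXa]; push_cast; nlinarith [mul_nonneg hX0.le ha₀0.le]
  have hXsB0 : 0 ≤ Xp * sB := mul_nonneg hX0.le hsB0
  have hℓ : ((((3 : ℕ) + 2) * F.L : ℕ) : ℝ) = 5 * F.L := by push_cast; ring
  have hε' : (F.L : ℝ) ^ 3 * ε₀ ≤ 1 / 10 ^ 12 := by
    rw [le_div_iff₀ (by positivity)]; linarith
  have he' : (F.L : ℝ) ^ 2 * e ≤ 1 / 10 ^ 9 := by
    rw [le_div_iff₀ (by positivity)]; linarith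
  have hL23 : (F.L : ℝ) ^ 2 ≤ (F.L : ℝ) ^ 3 := pow_le_pow_right₀ hL1 (by norm_num)
  have hL12 : (F.L : ℝ) ≤ (F.L : ℝ) ^ 2 := by nlinarith
  have hL2ε : (F.L : ℝ) ^ 2 * ε₀ ≤ (F.L : ℝ) ^ 3 * ε₀ := mul_le_mul_of_nonneg_right hL23 hε₀.le
  have hLε : (F.L : ℝ) * ε₀ ≤ (F.L : ℝ) ^ 2 * ε₀ := mul_le_mul_of_nonneg_right hL12 hε₀.le
  have hLe : (F.L : ℝ) * e ≤ (F.L : ℝ) ^ 2 * e := mul_le_mul_of_nonneg_right hL12 he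
  have hbud₀ : 6400 * ((((3 : ℕ) + 2) * F.L : ℕ) : ℝ) ^ 2 * Xp * sB ≤ 1 := by
    rw [hℓ]
    have : 6400 * (5 * (F.L : ℝ)) ^ 2 * Xp * sB = 160000 * (F.L : ℝ) ^ 2 * (Xp * sB) := by ring
    rw [this]; nlinarith [sq_nonneg (F.L : ℝ)]
  have hbud : 8 * (16 * (22100 : ℝ) + 2) * ((((3 : ℕ) + 2) * F.L : ℕ) : ℝ) ^ 2 * (Xp * (2 * t + 30 * ((((3 : ℕ) + 2) * F.L : ℕ) : ℝ) * sB)) ≤ 1 := by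
    rw [hℓ]
    have : 8 * (16 * (22100 : ℝ) + 2) * (5 * (F.L : ℝ)) ^ 2 * (Xp * (2 * t + 30 * (5 * (F.L : ℝ)) * sB)) =
        141440800 * (F.L : ℝ) ^ 2 * (Xp * t) + 10608060000 * (F.L : ℝ) ^ 3 * (Xp * sB) := by ring
    rw [this, hXt]; nlinarith [pow_nonneg hL0.le 3]
  have hρ : 48 * ((((3 : ℕ) + 2) * F.L : ℕ) : ℝ) *
      (2 * (Xp * (2 * t + 30 * ((((3 : ℕ) + 2) * F.L : ℕ) : ℝ) * sB)) + 30 * ((((3 : ℕ) + 2) * F.L : ℕ) : ℝ) * Xp * sB) ≤ 1 := by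
    rw [hℓ]
    have : 48 * (5 * (F.L : ℝ)) * (2 * (Xp * (2 * t + 30 * (5 * (F.L : ℝ)) * sB)) + 30 * (5 * (F.L : ℝ)) * Xp * sB) =
        960 * (F.L : ℝ) * (Xp * t) + 108000 * (F.L : ℝ) ^ 2 * (Xp * sB) := by ring
    rw [this, hXt]; nlinarith [sq_nonneg (F.L : ℝ)]
  -- §1 at the top bond `ĉ`
  have h1 := dbarCovIterU_emlIterU_mem_specialUnitaryGroup_of_plaqSmall (P := F.P K) (C₁ := 22100) (by norm_num) hstep_of_W1 hframe_of_W1 hk1 U₀ ha₀0 hU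
    (fun b => Complex.I • X b) ht0 ht1 hA (fun b => coe_expUnit_I_smul_mem_specialUnitaryGroup (hXsa b) (hXtr b))
    (by rw [hd, hLn, ← hXp, ← hsB]; exact hbud₀) (by rw [hd, hLn, ← hXp, ← hsB]; exact hbud) (by rw [hd, hLn, ← hXp, ← hsB]; exact hρ)
    (bondShift (sites_eq F n K h) c)
  -- (92): `dbarTwS = U̿^{(k)}·(Ū₀^{(k)})⁻¹`
  rw [dbarTwS_eq_dbarCovIterU_mul_inv, bgUnits_eq_unitsField]
  refine Subgroup.mul_mem _ ?_ (Subgroup.inv_mem _ ?_)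
  · rw [mem_specialUnitaryUnits]; exact h1.1
  · rw [mem_specialUnitaryUnits]; exact h1.2

end T3

end Summit.QuantumFields.YangMills.Theorems.Prop7SymFrameBound

end
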